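import Literature.Analysis.FluidPDE.MollifiedWeakEuler
import Literature.Analysis.FluidPDE.NavierStokesReynolds
import Literature.Analysis.FluidPDE.NSRPerturbation
import HarnessLib

/-!
# The Navier–Stokes–Reynolds triple of a mollified weak Euler solution (Buckmaster–Vicol §2.5)

Analysis/FluidPDE support file (serves the discharge of
`Literature.Barriers.AnomalousDissipation.BuckmasterVicol2019_mollifiedEulerStart`; Buckmaster–Vicol,
Ann. of Math. 189 (2019), §2.5: "there exists a mean-free `p_n` such that
`∂ₜ v_n + div (v_n ⊗ v_n) + ∇p_n - λ_n^{-2} Δ v_n = div R̊_n`, where `R̊_n` is the traceless symmetric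
part of the tensor `(v_n ⊗ v_n) - ((u ⊗ u) ∗ₓ φ) ∗ₜ ϕ - λ_n^{-2} ∇v_n`").

Given admissible data `U` on `ℝ × T^d` (bounded, strongly measurable, vanishing off a slab, weakly
divergence free at a.e. time), the mollified velocity `V = mollifiedField φ ε U`, flux
`𝒯 = mollifiedFlux φ ε U` and a smooth mean-free scalar `q` on an open time set `S` with
`∇q = ∂ₜV + div 𝒯` there (the pressure of `TorusPressureReconstruction` applied to the residual of
`MollifiedWeakEuler`), we define, for a viscosity `ν` and a time shift `t₀`,

* `Torus.startStressRaw φ ε ν U t = V ⊗ V - 𝒯 - ν (∇V + ∇Vᵀ)` (with `Torus.symGrad` of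
  `NSRPerturbation` for `∇V + ∇Vᵀ`) and the triple
  `Torus.startVelocity` (`t ↦ V(t + t₀)`), `Torus.startStress` (the traceless part of the raw stress,
  shifted) and `Torus.startPressure` (`-q - tr(raw)/d`, normalised to zero mean, shifted),

and prove `Torus.isNSReynoldsOn_start`: on every interval `[0, T]` with `[t₀, t₀ + T] ⊆ S` the triple is
a classical Navier–Stokes–Reynolds solution (`Torus.IsNSReynoldsOn`) with divergence-free velocity,
for **every** `ν` — the viscous term is carried by the stress through
`div (∇V + ∇Vᵀ) = ΔV` (`Torus.tensorDivergence_symGrad` of `NSRPerturbation`, using `div V = 0`). This is the algebra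
of BV's display: `∂ₜV + div(V ⊗ V) + ∇p = νΔV + div R̊` with
`R̊ = (V ⊗ V - 𝒯 - ν(∇V + ∇Vᵀ))̊`, `p = -q - tr(V ⊗ V - 𝒯)/d`.

## Mathlib / tree search

Reused: `Torus.symGrad`, `symGrad_symm`, `IsSmooth.symGrad`, `IsSmoothSpaceTimeOn.symGrad`,
`tensorDivergence_symGrad` (`NSRPerturbation`), `Torus.tensorProd`, `tensorDivergence_tensorProd`,
`Torus.traceless`, `tensorTrace`, `tensorDivergence_traceless`, `tensorDivergence_sub`,
`IsSmoothSpaceTimeOn.{tensorProd, traceless, tensorTrace, partialDeriv, gradient, integral_const}`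
(`EulerReynoldsMollification`, `NavierStokesConcentrationTools`, `TorusSpaceTime`), the mollified
field calculus of `OnsagerProofs` and `MollifiedWeakEuler`. `IsSmoothSpaceTimeOn.tensorDivergence`
exists for `T³` inside the BDSV files (`OnsagerBDSVPerturbationSmooth`) and, for general `d`, inside
the Cheskidov–Luo files (`CLPerturbation`, namespace `CL22.Datum`); the light general-`d` lemma
`Torus.isSmoothSpaceTimeOn_tensorDivergence` here avoids both import cones. No named facts.

## References

* T. Buckmaster, V. Vicol, Ann. of Math. 189 (2019), §2.5. [`BuckmasterVicol2019Annals`]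
-/

noncomputable section

open MeasureTheory TopologicalSpace Set Function Filter Metric ContinuousLinearMap
open _root_.Topology
open scoped ENNReal NNReal Convolution InnerProductSpace ContDiff

namespace Literature.Analysis.FluidPDE

namespace Torus

open FunctionSpaces.Torus (stLift lift kernel IsSmooth IsContDiff IsDivFree mollifiedField vecMollify)
open FunctionSpaces (timeAvgWith)

variable {d : Type*} [Fintype d] [DecidableEq d]

/-! ## Divergence of jointly smooth tensor fields -/

section TensorDiv

/-- The divergence of a jointly smooth tensor field is jointly smooth (general `d`; the `T³` form
is `IsSmoothSpaceTimeOn.tensorDivergence` of the BDSV files, and `CL22.Datum` has a copy inside the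
Cheskidov–Luo files; this light copy avoids those imports). [folklore] -/
theorem isSmoothSpaceTimeOn_tensorDivergence {S : Set ℝ} {σ : ℝ → UnitAddTorus d → d → EuclideanSpace ℝ d}
    (hσ : FunctionSpaces.Torus.IsSmoothSpaceTimeOn S σ) (hS : UniqueDiffOn ℝ S) :
    FunctionSpaces.Torus.IsSmoothSpaceTimeOn S (fun t => tensorDivergence (σ t)) :=
  FunctionSpaces.Torus.IsSmoothSpaceTimeOn.sum fun j _ => (hσ.column j).partialDeriv hS j

end TensorDiv

/-! ## The mollified flux is symmetric; smoothness of the mollified objects in space–time -/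

section Flux

variable {U : ℝ → UnitAddTorus d → EuclideanSpace ℝ d} {φ : ContDiffBump (0 : ℝ)} {ε M T₀ : ℝ}

omit [DecidableEq d] in
/-- The mollified flux is a symmetric tensor: `𝒯ᵢⱼ = 𝒯ⱼᵢ` (both are the mollification of `UᵢUⱼ`). [folklore] -/
theorem mollifiedFlux_symm (hUm : StronglyMeasurable (uncurry U)) (hUb : ∀ s y, ‖U s y‖ ≤ M)
    (hU0 : ∀ s, s ∉ Icc 0 T₀ → U s = 0) (hε : 0 < ε) (hε' : ε ≤ 1 / 4) (t : ℝ) (x : UnitAddTorus d) (i j : d) :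
    mollifiedFlux φ ε U t x i j = mollifiedFlux φ ε U t x j i := by
  have hUi : ∀ k : d, Integrable (uncurry fun s y => U s y k • U s y) ((volume : Measure ℝ).prod volume) :=
    fun k => integrable_uncurry_smul_apply hUm hUb hU0 k
  rw [mollifiedFlux_apply, mollifiedFlux_apply, mollifiedField_apply_eq_timeAvgWith (hUi i) hε hε',
    mollifiedField_apply_eq_timeAvgWith (hUi j) hε hε']
  congr 1
  funext s
  congr 1
  funext y
  simp only [PiLp.smul_apply, smul_eq_mul]
  ring

omit [Fintype d] [DecidableEq d] in
/-- Time translation of a field with smooth space–time lift is jointly smooth on every time set. [folklore] -/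
theorem isSmoothSpaceTimeOn_comp_add_of_contDiff [Fintype d] {F : Type*} [NormedAddCommGroup F]
    [NormedSpace ℝ F] {w : ℝ → UnitAddTorus d → F} (hw : ContDiff ℝ ∞ (stLift w)) (S : Set ℝ) (t₀ : ℝ) :
    FunctionSpaces.Torus.IsSmoothSpaceTimeOn S (fun t => w (t + t₀)) := by
  have hφ : ContDiff ℝ ∞ (fun z : ℝ × EuclideanSpace ℝ d => (z.1 + t₀, z.2)) :=
    (contDiff_fst.add contDiff_const).prodMk contDiff_snd
  change ContDiffOn ℝ ∞ (stLift w ∘ fun z : ℝ × EuclideanSpace ℝ d => (z.1 + t₀, z.2)) (S ×ˢ univ)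
  exact (hw.comp hφ).contDiffOn

omit [DecidableEq d] in
/-- The mollified field is jointly smooth on all of `ℝ × T^d` (hence on every time set). [folklore] -/
theorem isSmoothSpaceTimeOn_mollifiedField (hUm : StronglyMeasurable (uncurry U)) (hUb : ∀ s y, ‖U s y‖ ≤ M)
    (hU0 : ∀ s, s ∉ Icc 0 T₀ → U s = 0) (hε : 0 < ε) (hε' : ε ≤ 1 / 4) (S : Set ℝ) (t₀ : ℝ) :
    FunctionSpaces.Torus.IsSmoothSpaceTimeOn S (fun t => mollifiedField φ ε U (t + t₀)) :=
  isSmoothSpaceTimeOn_comp_add_of_contDiff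
    (contDiff_stLift_mollifiedField (φ := φ) (integrable_uncurry_of_bounded hUm hUb hU0) hε hε') S t₀

omit [DecidableEq d] in
/-- The mollified flux is jointly smooth on all of `ℝ × T^d` (hence on every time set). [folklore] -/
theorem isSmoothSpaceTimeOn_mollifiedFlux (hUm : StronglyMeasurable (uncurry U)) (hUb : ∀ s y, ‖U s y‖ ≤ M)
    (hU0 : ∀ s, s ∉ Icc 0 T₀ → U s = 0) (hε : 0 < ε) (hε' : ε ≤ 1 / 4) (S : Set ℝ) (t₀ : ℝ) :
    FunctionSpaces.Torus.IsSmoothSpaceTimeOn S (fun t => mollifiedFlux φ ε U (t + t₀)) := by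
  refine isSmoothSpaceTimeOn_tensor_iff.2 fun j => ?_
  have h := contDiff_stLift_mollifiedField (φ := φ) (integrable_uncurry_smul_apply hUm hUb hU0 j) hε hε'
  exact isSmoothSpaceTimeOn_comp_add_of_contDiff (w := fun t x => mollifiedFlux φ ε U t x j) h S t₀

omit [DecidableEq d] in
/-- The time derivative of the mollified field is jointly smooth on all of `ℝ × T^d`. [folklore] -/
theorem isSmoothSpaceTimeOn_timeDeriv_mollifiedField (hUm : StronglyMeasurable (uncurry U))
    (hUb : ∀ s y, ‖U s y‖ ≤ M) (hU0 : ∀ s, s ∉ Icc 0 T₀ → U s = 0) (hε : 0 < ε) (hε' : ε ≤ 1 / 4)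
    (S : Set ℝ) :
    FunctionSpaces.Torus.IsSmoothSpaceTimeOn S (FunctionSpaces.Torus.timeDeriv (mollifiedField φ ε U)) :=
  FunctionSpaces.Torus.isSmoothSpaceTimeOn_of_contDiff
    (isSpaceTimeTest_mollifiedField (φ := φ) (integrable_uncurry_of_bounded hUm hUb hU0) hε hε' hU0).timeDeriv.1 S

end Flux

/-! ## The triple -/

section Triple

variable (φ : ContDiffBump (0 : ℝ)) (ε ν : ℝ) (U : ℝ → UnitAddTorus d → EuclideanSpace ℝ d)

/-- **The raw Reynolds stress of the mollified start** at slab time `t`: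
`V ⊗ V - 𝒯 - ν (∇V + ∇Vᵀ)` with `V = mollifiedField φ ε U`, `𝒯 = mollifiedFlux φ ε U`
(Buckmaster–Vicol 2019, §2.5, before taking the traceless part; `symGrad V = ∇V + ∇Vᵀ` by columns). [cite: BuckmasterVicol2019Annals, §2.5] -/
def startStressRaw (t : ℝ) : UnitAddTorus d → d → EuclideanSpace ℝ d :=
  fun x j => tensorProd (mollifiedField φ ε U t) (mollifiedField φ ε U t) x j - mollifiedFlux φ ε U t x j -
    ν • symGrad (mollifiedField φ ε U t) x j

/-- **The velocity of the start**: the mollified field read at the shifted time `t + t₀`. [cite: BuckmasterVicol2019Annals, §2.5] -/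
def startVelocity (t₀ : ℝ) : ℝ → UnitAddTorus d → EuclideanSpace ℝ d :=
  fun t => mollifiedField φ ε U (t + t₀)

/-- **The Reynolds stress of the start**: the traceless part `R̊` of the raw stress, shifted in time. [cite: BuckmasterVicol2019Annals, §2.5] -/
def startStress (t₀ : ℝ) : ℝ → UnitAddTorus d → d → EuclideanSpace ℝ d :=
  fun t => traceless (startStressRaw φ ε ν U (t + t₀))

/-- **The pressure of the start**: `p = -q - tr(raw)/d`, normalised to zero mean, shifted in time
(`q` is the potential of the residual, `∇q = ∂ₜV + div 𝒯`; "mean-free `p_n`"). [cite: BuckmasterVicol2019Annals, §2.5] -/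
def startPressure (q : ℝ → UnitAddTorus d → ℝ) (t₀ : ℝ) : ℝ → UnitAddTorus d → ℝ :=
  fun t x => -q (t + t₀) x - tensorTrace (startStressRaw φ ε ν U (t + t₀)) x / Fintype.card d +
    ∫ z, tensorTrace (startStressRaw φ ε ν U (t + t₀)) z / Fintype.card d

end Triple

/-! ## The triple solves the Navier–Stokes–Reynolds system -/

section NSR

variable {U : ℝ → UnitAddTorus d → EuclideanSpace ℝ d} {φ : ContDiffBump (0 : ℝ)} {ε ν M T₀ : ℝ}

variable (hUm : StronglyMeasurable (uncurry U)) (hUb : ∀ s y, ‖U s y‖ ≤ M)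
  (hU0 : ∀ s, s ∉ Icc 0 T₀ → U s = 0) (hε : 0 < ε) (hε' : ε ≤ 1 / 4)
include hUm hUb hU0 hε hε'

/-- Slices of the raw stress are smooth. [folklore] -/
theorem isSmooth_startStressRaw (t : ℝ) : IsSmooth (startStressRaw φ ε ν U t) := by
  have hUi := integrable_uncurry_of_bounded hUm hUb hU0
  have hV : IsSmooth (mollifiedField φ ε U t) := isSmooth_mollifiedField hUi hε hε' t
  have hT : IsSmooth (mollifiedFlux φ ε U t) := isSmooth_mollifiedFlux (φ := φ) hUm hUb hU0 hε hε' t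
  exact isSmooth_tensor fun j => (((hV.tensorProd hV).column j).sub (hT.column j)).sub
    ((hV.symGrad.column j).smul ν)

/-- The raw stress is symmetric. [folklore] -/
theorem startStressRaw_symm (t : ℝ) (x : UnitAddTorus d) (i j : d) :
    startStressRaw φ ε ν U t x i j = startStressRaw φ ε ν U t x j i := by
  have hUi := integrable_uncurry_of_bounded hUm hUb hU0
  have hV : IsSmooth (mollifiedField φ ε U t) := isSmooth_mollifiedField hUi hε hε' t
  simp only [startStressRaw, PiLp.sub_apply, PiLp.smul_apply, tensorProd_apply, smul_eq_mul]
  rw [mollifiedFlux_symm (φ := φ) hUm hUb hU0 hε hε' t x i j, symGrad_symm (hV.isContDiff (by simp)) x i j, mul_comm]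

/-- The raw stress, shifted in time, is jointly smooth on every interval. [folklore] -/
theorem isSmoothSpaceTimeOn_startStressRaw {T : ℝ} (hT : 0 < T) (t₀ : ℝ) :
    FunctionSpaces.Torus.IsSmoothSpaceTimeOn (Icc 0 T) (fun t => startStressRaw φ ε ν U (t + t₀)) := by
  have hU : UniqueDiffOn ℝ (Icc 0 T) := uniqueDiffOn_Icc hT
  have hV := isSmoothSpaceTimeOn_mollifiedField (φ := φ) hUm hUb hU0 hε hε' (Icc 0 T) t₀
  have hT' := isSmoothSpaceTimeOn_mollifiedFlux (φ := φ) hUm hUb hU0 hε hε' (Icc 0 T) t₀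
  exact ((hV.tensorProd hV).sub hT').sub ((hV.symGrad hU).const_smul ν)

omit hUm hUb hU0 hε hε' in
omit [Fintype d] [DecidableEq d] in
/-- A field jointly smooth on an open time set `S` is, after the time shift `t ↦ t + t₀`, jointly
smooth on every interval `[0, T]` with `[t₀, t₀ + T] ⊆ S`. [folklore] -/
theorem isSmoothSpaceTimeOn_comp_add_of_subset [Fintype d] {F : Type*} [NormedAddCommGroup F] [NormedSpace ℝ F]
    {S : Set ℝ} {w : ℝ → UnitAddTorus d → F} (hw : FunctionSpaces.Torus.IsSmoothSpaceTimeOn S w) {t₀ T : ℝ}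
    (hsub : ∀ t ∈ Icc 0 T, t + t₀ ∈ S) :
    FunctionSpaces.Torus.IsSmoothSpaceTimeOn (Icc 0 T) (fun t => w (t + t₀)) := by
  have hφ : ContDiff ℝ ∞ (fun z : ℝ × EuclideanSpace ℝ d => (z.1 + t₀, z.2)) :=
    (contDiff_fst.add contDiff_const).prodMk contDiff_snd
  have hmaps : MapsTo (fun z : ℝ × EuclideanSpace ℝ d => (z.1 + t₀, z.2)) (Icc 0 T ×ˢ univ) (S ×ˢ univ) :=
    fun z hz => ⟨hsub z.1 hz.1, mem_univ _⟩
  change ContDiffOn ℝ ∞ (stLift w ∘ fun z : ℝ × EuclideanSpace ℝ d => (z.1 + t₀, z.2)) (Icc 0 T ×ˢ univ)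
  exact hw.comp hφ.contDiffOn hmaps

omit hUm hUb hU0 hε hε' in
omit [Fintype d] [DecidableEq d] in
/-- The torus gradient ignores additive constants (additive form). [folklore] -/
theorem gradient_add_const' [Fintype d] (f : UnitAddTorus d → ℝ) (a : ℝ) (x : UnitAddTorus d) :
    FunctionSpaces.Torus.gradient (fun y => f y + a) x = FunctionSpaces.Torus.gradient f x := by
  have h := gradient_sub_const f (-a) x
  simpa [sub_neg_eq_add] using h

/-- **The mollified start solves the Navier–Stokes–Reynolds system** (Buckmaster–Vicol 2019, §2.5:
"`∂ₜ v_n + div (v_n ⊗ v_n) + ∇p_n - λ_n^{-2} Δ v_n = div R̊_n`"). Let `U` be admissible data, weakly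
divergence free at a.e. time, and let `q` be jointly smooth on a time set `S`, of zero mean,
with `∇q(t) = ∂ₜV(t) + div 𝒯(t)` for `t ∈ S` (the pressure of the residual). Then for every
viscosity `ν`, every `T > 0` and every shift `t₀` with `[t₀, t₀ + T] ⊆ S`, the triple
`(startVelocity, startPressure, startStress)` is a classical Navier–Stokes–Reynolds solution on
`[0, T] × T^d` (`Torus.IsNSReynoldsOn`). [cite: BuckmasterVicol2019Annals, §2.5] -/
theorem isNSReynoldsOn_start (hdiv : ∀ᵐ s, FunctionSpaces.Torus.IsWeaklyDivFree (U s)) {S : Set ℝ}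
    {q : ℝ → UnitAddTorus d → ℝ} (hq : FunctionSpaces.Torus.IsSmoothSpaceTimeOn S q)
    (hgrad : ∀ t ∈ S, ∀ x, FunctionSpaces.Torus.gradient (q t) x = mollifiedEulerResidual φ ε U t x)
    (hqmean : ∀ t ∈ S, FunctionSpaces.Torus.HasZeroMean (q t)) (ν : ℝ) {T : ℝ} (hT : 0 < T) {t₀ : ℝ}
    (hsub : ∀ t ∈ Icc 0 T, t + t₀ ∈ S) :
    IsNSReynoldsOn (Icc 0 T) ν (startVelocity φ ε U t₀) (startPressure φ ε ν U q t₀) (startStress φ ε ν U t₀) := by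
  have hUi := integrable_uncurry_of_bounded hUm hUb hU0
  have hU : UniqueDiffOn ℝ (Icc 0 T) := uniqueDiffOn_Icc hT
  have hcv : Convex ℝ (Icc 0 T) := convex_Icc 0 T
  -- smoothness of the pieces
  have hV := isSmoothSpaceTimeOn_mollifiedField (φ := φ) hUm hUb hU0 hε hε' (Icc 0 T) t₀
  have hraw := isSmoothSpaceTimeOn_startStressRaw (φ := φ) (ν := ν) hUm hUb hU0 hε hε' hT t₀
  have hq' : FunctionSpaces.Torus.IsSmoothSpaceTimeOn (Icc 0 T) (fun t => q (t + t₀)) :=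
    isSmoothSpaceTimeOn_comp_add_of_subset hq hsub
  have hθ : FunctionSpaces.Torus.IsSmoothSpaceTimeOn (Icc 0 T)
      (fun t x => tensorTrace (startStressRaw φ ε ν U (t + t₀)) x / Fintype.card d) :=
    ContDiffOn.div_const hraw.tensorTrace _
  refine
    { smooth_velocity := hV
      smooth_pressure := ((hq'.neg.sub hθ).add (hθ.integral_const hU hcv))
      smooth_stress := hraw.traceless
      momentum := fun t ht x => ?_
      divFree := fun t _ => isDivFree_mollifiedField hUi hdiv hε hε' (t + t₀)
      symm := fun t _ x i j => traceless_symm (fun i j => startStressRaw_symm (φ := φ) (ν := ν) hUm hUb hU0 hε hε' _ x i j) i j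
      traceFree := fun t _ x => sum_traceless_apply_apply _ x
      hasZeroMean_pressure := fun t ht => ?_ }
  · -- the momentum equation at the shifted time `t' = t + t₀`
    set t' := t + t₀ with ht'
    have ht'S : t' ∈ S := hsub t ht
    have hVs : IsSmooth (mollifiedField φ ε U t') := isSmooth_mollifiedField hUi hε hε' t'
    have hTs : IsSmooth (mollifiedFlux φ ε U t') := isSmooth_mollifiedFlux (φ := φ) hUm hUb hU0 hε hε' t'
    have hraws : IsSmooth (startStressRaw φ ε ν U t') := isSmooth_startStressRaw (φ := φ) (ν := ν) hUm hUb hU0 hε hε' t'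
    have hGs : IsSmooth (symGrad (mollifiedField φ ε U t')) := hVs.symGrad
    -- (1) the time derivative
    have h1 : FunctionSpaces.Torus.timeDerivWithin (Icc 0 T) (startVelocity φ ε U t₀) t x =
        FunctionSpaces.Torus.timeDeriv (mollifiedField φ ε U) t' x := by
      have hψ : ContDiff ℝ ∞ (stLift (startVelocity φ ε U t₀)) := by
        have h := contDiff_stLift_mollifiedField (φ := φ) hUi hε hε'
        have hφ : ContDiff ℝ ∞ (fun z : ℝ × EuclideanSpace ℝ d => (z.1 + t₀, z.2)) :=
          (contDiff_fst.add contDiff_const).prodMk contDiff_snd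
        change ContDiff ℝ ∞ (stLift (mollifiedField φ ε U) ∘ fun z : ℝ × EuclideanSpace ℝ d => (z.1 + t₀, z.2))
        exact h.comp hφ
      rw [FunctionSpaces.Torus.timeDerivWithin_eq_timeDeriv_of_contDiff hψ hU ht x, FunctionSpaces.Torus.timeDeriv,
        FunctionSpaces.Torus.timeDeriv]
      exact deriv_comp_add_const (fun s => mollifiedField φ ε U s x) t₀ t
    -- (2) the convective term
    have h2 : FunctionSpaces.Torus.convect (mollifiedField φ ε U t') (mollifiedField φ ε U t') x =
        tensorDivergence (tensorProd (mollifiedField φ ε U t') (mollifiedField φ ε U t')) x := by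
      rw [tensorDivergence_tensorProd hVs hVs, isDivFree_mollifiedField hUi hdiv hε hε' t' x, zero_smul, add_zero]
    -- (3) the divergence of the stress
    have h3 : tensorDivergence (startStress φ ε ν U t₀ t) x = tensorDivergence (startStressRaw φ ε ν U t') x -
        FunctionSpaces.Torus.gradient (fun y => tensorTrace (startStressRaw φ ε ν U t') y / Fintype.card d) x :=
      tensorDivergence_traceless hraws x
    have h4 : tensorDivergence (startStressRaw φ ε ν U t') x =
        tensorDivergence (tensorProd (mollifiedField φ ε U t') (mollifiedField φ ε U t')) x -
          tensorDivergence (mollifiedFlux φ ε U t') x - ν • FunctionSpaces.Torus.laplacian (mollifiedField φ ε U t') x := by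
      have hA : IsSmooth fun y j => tensorProd (mollifiedField φ ε U t') (mollifiedField φ ε U t') y j - mollifiedFlux φ ε U t' y j :=
        isSmooth_tensor fun j => ((hVs.tensorProd hVs).column j).sub (hTs.column j)
      have hB : IsSmooth fun y j => ν • symGrad (mollifiedField φ ε U t') y j :=
        isSmooth_tensor fun j => (hGs.column j).smul ν
      change tensorDivergence (fun y j => (tensorProd (mollifiedField φ ε U t') (mollifiedField φ ε U t') y j -
        mollifiedFlux φ ε U t' y j) - ν • symGrad (mollifiedField φ ε U t') y j) x = _
      rw [tensorDivergence_sub hA hB x, tensorDivergence_sub (hVs.tensorProd hVs) hTs x,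
        tensorDivergence_const_smul_apply (hGs.isContDiff (by simp)) ν x,
        tensorDivergence_symGrad hVs (isDivFree_mollifiedField hUi hdiv hε hε' t') x]
    -- (4) the pressure gradient
    have h5 : FunctionSpaces.Torus.gradient (startPressure φ ε ν U q t₀ t) x =
        -(FunctionSpaces.Torus.gradient (q t') x) -
          FunctionSpaces.Torus.gradient (fun y => tensorTrace (startStressRaw φ ε ν U t') y / Fintype.card d) x := by
      have hqs : IsSmooth (q t') := hq.isSmooth_slice ht'S
      have hθs : IsSmooth fun y => tensorTrace (startStressRaw φ ε ν U t') y / Fintype.card d :=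
        ContDiff.div_const hraws.tensorTrace _
      change FunctionSpaces.Torus.gradient (fun y => -q t' y - tensorTrace (startStressRaw φ ε ν U t') y / Fintype.card d +
        ∫ z, tensorTrace (startStressRaw φ ε ν U t') z / Fintype.card d) x = _
      rw [gradient_add_const']
      have hneg : (fun y => -q t' y - tensorTrace (startStressRaw φ ε ν U t') y / Fintype.card d) =
          fun y => (-1) * q t' y + (-1) * (tensorTrace (startStressRaw φ ε ν U t') y / Fintype.card d) := by
        funext y; ring
      have h1c : IsContDiff 1 (fun y => (-1) * q t' y) := by
        show ContDiff ℝ 1 (fun z => (-1) * lift (q t') z)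
        exact contDiff_const.mul (hqs.isContDiff (by simp))
      have h2c : IsContDiff 1 (fun y => (-1) * (tensorTrace (startStressRaw φ ε ν U t') y / Fintype.card d)) := by
        show ContDiff ℝ 1 (fun z => (-1) * lift (fun y => tensorTrace (startStressRaw φ ε ν U t') y / Fintype.card d) z)
        exact contDiff_const.mul (hθs.isContDiff (by simp))
      rw [hneg, gradient_add_apply h1c h2c, gradient_const_mul_apply (hqs.isContDiff (by simp)),
        gradient_const_mul_apply (hθs.isContDiff (by simp))]
      simp only [neg_smul, one_smul]
      abel
    -- assemble
    show FunctionSpaces.Torus.timeDerivWithin (Icc 0 T) (startVelocity φ ε U t₀) t x +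
        FunctionSpaces.Torus.convect (mollifiedField φ ε U t') (mollifiedField φ ε U t') x +
        FunctionSpaces.Torus.gradient (startPressure φ ε ν U q t₀ t) x =
      ν • FunctionSpaces.Torus.laplacian (mollifiedField φ ε U t') x + tensorDivergence (startStress φ ε ν U t₀ t) x
    rw [h1, h2, h5, h3, h4, hgrad t' ht'S x, mollifiedEulerResidual_apply]
    abel
  · -- zero mean of the pressure
    set t' := t + t₀ with ht'
    have ht'S : t' ∈ S := hsub t ht
    have hraws : IsSmooth (startStressRaw φ ε ν U t') := isSmooth_startStressRaw (φ := φ) (ν := ν) hUm hUb hU0 hε hε' t'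
    have hqi : Integrable (q t') volume := (hq.isSmooth_slice ht'S).continuous.integrable_unitAddTorus
    have hθs : IsSmooth fun y => tensorTrace (startStressRaw φ ε ν U t') y / Fintype.card d :=
      ContDiff.div_const hraws.tensorTrace _
    have hθi : Integrable (fun y => tensorTrace (startStressRaw φ ε ν U t') y / Fintype.card d) volume :=
      hθs.continuous.integrable_unitAddTorus
    have hq0 : ∫ x, q t' x = 0 := hqmean t' ht'S
    show ∫ x, (-q t' x - tensorTrace (startStressRaw φ ε ν U t') x / Fintype.card d +
      ∫ z, tensorTrace (startStressRaw φ ε ν U t') z / Fintype.card d) = 0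
    have hqn : Integrable (fun x => -q t' x) volume := hqi.neg
    have hqs : Integrable (fun x => -q t' x - tensorTrace (startStressRaw φ ε ν U t') x / Fintype.card d) volume :=
      hqn.sub hθi
    rw [integral_add hqs (integrable_const _), integral_sub hqn hθi, integral_neg, hq0,
      MeasureTheory.integral_const, smul_eq_mul, probReal_univ]
    ring

end NSR


end Torus

end Literature.Analysis.FluidPDE

end
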